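import Summits.QuantumFields.BalabanUV.T4Continuum.Support.SubstrateLargeField

/-!
# T⁴ programme, SUBSTRATE — `Support/SubstrateLargeFieldNested` (part 2 of `Support/SubstrateLargeField`): RESTRICTED and
# NESTED (history-indexed) large∕small-field decompositions of record — tests only on a plaquette set `S`, and a finite
# sequence of STAGES whose test sets depend on the earlier OUTCOMES; every total is the density

Audit cell `pub-balaban`, SUBSTRATE cell seat p4; typer MAP §4 l.68 «v2 of the file = the NESTED sequence … which is where S-GEOM
and S-LF meet and what NE7b H3's R-operation (S-R) is typed on».  Same vocabulary of record (V1 = `Setup`), same namespace as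
part 1 (`lfPiece`, `lfPiece_total`, `chiPlaq`, `largeSet`, `lfDecompOfRecord` imported BY NAME).

WHAT IS PRINTED (documentation; nothing asserted).  In [Balaban1988Convergent] §1 pp. 245–248 and [Balaban1989LargeFieldI] (1.3)–(1.9)
p. 178 the characteristic functions of a step are introduced IN SEQUENCE, each new family only on the region the previous outcomes
left small-field (e.g. (1.4) p. 246: *"where the sum is over sets P₁ ⊂ (P₀′~)ᶜ"*; (1.8): *"the sum is over sets Q₁ ⊂ (B(P₁¹))~⁻¹"*):
the large-field regions of a density form a HISTORY `(Z₀, Z₁, …)` with `Z_i ⊆ S_i(Z₀, …, Z_{i−1})`.  Row NE7b types the histories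
themselves (`Support/History*`); this file types only the product-of-cut-offs bookkeeping that makes «Σ over admissible histories
of the pieces = the density» a theorem.

WHAT THIS FILE PROVIDES (all `[folklore]`; general weights `χ_p`):
 * §1 RESTRICTED PIECES `lfPieceOn S χ ρ Z V = ρ V · Π_{p∈Z}(1 − χ_p V) · Π_{p∈S∖Z} χ_p V` (tests only on `S`): **`lfPieceOn_total`**
   `Σ_{Z ⊆ S} lfPieceOn S χ ρ Z = ρ`, `lfPieceOn_univ = lfPiece`, positivity∕domination, the sharp reading
   `lfPieceOn S (chiPlaq δ) ρ Z V = if Z = S ∩ largeSet δ V then ρ V else 0` for `Z ⊆ S` (`lfPieceOn_chiPlaq`);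
 * §2 STAGES `Stage P j G = {tests : List (Finset Plaq) → Finset Plaq, wt : Plaq → GaugeField → ℝ}` (the test set of a stage is a
   function of the HISTORY of earlier outcomes), the ADMISSIBLE HISTORIES `admissible stages hist : Finset (List (Finset Plaq))`
   (`Z₀ ⊆ tests₀ hist`, `Z₁ ⊆ tests₁ (hist ++ [Z₀])`, …), the history piece `nestedPiece stages hist ρ outs` (iterated `lfPieceOn`), and
   **`sum_nestedPiece`**: `Σ_{outs ∈ admissible stages hist} nestedPiece stages hist ρ outs V = ρ V` — the n-stage partition of unity
   with outcome-dependent test sets (induction on the stages; `Finset.sum_biUnion` over the first outcome);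
 * §3 the packaging **`lfDecompNested stages ρ h : Setup.LargeFieldDecomp P j G`** with `Region :=` the admissible histories and
   **`lfDecompNested_total = ρ`**; positivity of the history pieces from `0 ≤ wt ≤ 1`, `0 ≤ ρ` (`nestedPiece_nonneg`).
HONEST FRAMING (T4-DAG p. 1).  Finite products and sums at ONE lattice level (the density's own); the rescalings between steps, the
geometry of the test sets (`S-GEOM`: `Support/SmallFieldDomains*`) and the analytic content of the pieces are NOT here; the 𝐑-operation
(S-R) is NOT defined here.  NOT an estimate of any NE row; spine 0/9 unchanged; NOT infinite volume, NOT a mass gap, NOT Clay.  HONEST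
DEPENDENCY: continuum YM on T⁴ ⇐ BetaPertH ∧ nine spine estimates (0/9 proved); BetaPertH ⇐ (D1) ∧ (D4) ∧ CAP+tail; G-an2-4 gates asym,
D1 and NE2/3/4.  No `sorry`.
-/

noncomputable section

open scoped BigOperators

namespace Summit.QuantumFields.BalabanUV.T4Continuum.SubstrateLargeField

open Literature.MathematicalPhysics.QuantumFieldTheory.Balaban1983to89

variable {P : Params} {j : ℕ} {G : Type*}

/-! ## §1 Restricted pieces: tests only on a plaquette set `S` -/

section Restricted
variable [DecidableEq (Plaq P j)]

/-- The piece with large-field set `Z` when only the plaquettes of `S` are tested: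
`ρ(V) · Π_{p ∈ Z}(1 − χ_p V) · Π_{p ∈ S∖Z} χ_p V`. [folklore] -/
def lfPieceOn (S : Finset (Plaq P j)) (χ : Plaq P j → GaugeField P j G → ℝ) (ρ : Density P j G) (Z : Finset (Plaq P j)) :
    Density P j G :=
  fun V => ρ V * (∏ p ∈ Z, (1 - χ p V)) * ∏ p ∈ S \ Z, χ p V

/-- Unfolding lemma. [folklore] -/
theorem lfPieceOn_apply (S : Finset (Plaq P j)) (χ : Plaq P j → GaugeField P j G → ℝ) (ρ : Density P j G)
    (Z : Finset (Plaq P j)) (V : GaugeField P j G) :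
    lfPieceOn S χ ρ Z V = ρ V * (∏ p ∈ Z, (1 - χ p V)) * ∏ p ∈ S \ Z, χ p V := rfl

/-- Testing every plaquette is part 1's `lfPiece`. [folklore] -/
theorem lfPieceOn_univ (χ : Plaq P j → GaugeField P j G → ℝ) (ρ : Density P j G) (Z : Finset (Plaq P j)) :
    lfPieceOn Finset.univ χ ρ Z = lfPiece χ ρ Z := by
  funext V
  rw [lfPieceOn_apply, lfPiece_apply, Finset.compl_eq_univ_sdiff]

/-- **RESTRICTED PARTITION OF UNITY**: `Σ_{Z ⊆ S} lfPieceOn S χ ρ Z V = ρ V` (`Finset.prod_add` on `S`). [folklore] -/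
theorem lfPieceOn_total (S : Finset (Plaq P j)) (χ : Plaq P j → GaugeField P j G → ℝ) (ρ : Density P j G)
    (V : GaugeField P j G) : ∑ Z ∈ S.powerset, lfPieceOn S χ ρ Z V = ρ V := by
  have h1 : ∏ p ∈ S, ((1 - χ p V) + χ p V) = 1 := Finset.prod_eq_one fun p _ => by ring
  have h2 : ∑ Z ∈ S.powerset, (∏ p ∈ Z, (1 - χ p V)) * ∏ p ∈ S \ Z, χ p V = 1 := by
    rw [← Finset.prod_add]; exact h1
  calc ∑ Z ∈ S.powerset, lfPieceOn S χ ρ Z V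
      = ρ V * ∑ Z ∈ S.powerset, (∏ p ∈ Z, (1 - χ p V)) * ∏ p ∈ S \ Z, χ p V := by
        rw [Finset.mul_sum]
        refine Finset.sum_congr rfl fun Z _ => ?_
        rw [lfPieceOn_apply, mul_assoc]
    _ = ρ V := by rw [h2, mul_one]

/-- Positivity of the restricted pieces under `0 ≤ χ ≤ 1`, `0 ≤ ρ`. [folklore] -/
theorem lfPieceOn_nonneg (S : Finset (Plaq P j)) {χ : Plaq P j → GaugeField P j G → ℝ} {ρ : Density P j G}
    (hχ : ∀ p V, 0 ≤ χ p V ∧ χ p V ≤ 1) (hρ : ∀ V, 0 ≤ ρ V) (Z : Finset (Plaq P j)) (V : GaugeField P j G) :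
    0 ≤ lfPieceOn S χ ρ Z V := by
  rw [lfPieceOn_apply]
  refine mul_nonneg (mul_nonneg (hρ V) (Finset.prod_nonneg fun p _ => ?_)) (Finset.prod_nonneg fun p _ => (hχ p V).1)
  linarith [(hχ p V).2]

/-- Pointwise positivity version (the density non-negative AT `V` suffices). [folklore] -/
theorem lfPieceOn_nonneg_at (S : Finset (Plaq P j)) {χ : Plaq P j → GaugeField P j G → ℝ} {ρ : Density P j G}
    (hχ : ∀ p V, 0 ≤ χ p V ∧ χ p V ≤ 1) {V : GaugeField P j G} (hρ : 0 ≤ ρ V) (Z : Finset (Plaq P j)) :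
    0 ≤ lfPieceOn S χ ρ Z V := by
  rw [lfPieceOn_apply]
  refine mul_nonneg (mul_nonneg hρ (Finset.prod_nonneg fun p _ => ?_)) (Finset.prod_nonneg fun p _ => (hχ p V).1)
  linarith [(hχ p V).2]

/-- Domination `lfPieceOn S χ ρ Z V ≤ ρ V` under `0 ≤ χ ≤ 1`, `0 ≤ ρ V`. [folklore] -/
theorem lfPieceOn_le_at (S : Finset (Plaq P j)) {χ : Plaq P j → GaugeField P j G → ℝ} {ρ : Density P j G}
    (hχ : ∀ p V, 0 ≤ χ p V ∧ χ p V ≤ 1) {V : GaugeField P j G} (hρ : 0 ≤ ρ V) (Z : Finset (Plaq P j)) :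
    lfPieceOn S χ ρ Z V ≤ ρ V := by
  rw [lfPieceOn_apply, mul_assoc]
  refine mul_le_of_le_one_right hρ ?_
  refine mul_le_one₀ (Finset.prod_le_one (fun p _ => ?_) fun p _ => ?_) (Finset.prod_nonneg fun p _ => (hχ p V).1)
    (Finset.prod_le_one (fun p _ => (hχ p V).1) fun p _ => (hχ p V).2)
  · linarith [(hχ p V).2]
  · linarith [(hχ p V).1]

variable [GaugeGroup G]

/-- **SHARP READING OF THE RESTRICTED PIECES**: for `Z ⊆ S`, `lfPieceOn S (chiPlaq δ) ρ Z V = ρ V` if `Z` is the large-field set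
of `V` SEEN ON `S` (`Z = S ∩ largeSet δ V`), else `0`. [folklore] -/
theorem lfPieceOn_chiPlaq (S : Finset (Plaq P j)) (δ : ℝ) (ρ : Density P j G) {Z : Finset (Plaq P j)} (hZ : Z ⊆ S)
    (V : GaugeField P j G) : lfPieceOn S (chiPlaq δ) ρ Z V = if Z = S ∩ largeSet δ V then ρ V else 0 := by
  rw [lfPieceOn_apply]
  split_ifs with hZeq
  · have h1 : ∏ p ∈ Z, (1 - chiPlaq δ p V) = 1 := by
      refine Finset.prod_eq_one fun p hp => ?_
      have hpL : p ∈ largeSet δ V := (Finset.mem_inter.mp (hZeq ▸ hp)).2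
      rw [(chiPlaq_eq_zero_iff δ p V).mpr ((mem_largeSet δ V p).mp hpL), sub_zero]
    have h2 : ∏ p ∈ S \ Z, chiPlaq δ p V = 1 := by
      refine Finset.prod_eq_one fun p hp => ?_
      obtain ⟨hpS, hpZ⟩ := Finset.mem_sdiff.mp hp
      have : ¬ δ ≤ dist1 (GaugeField.plaqHol V p) := fun hle =>
        hpZ (hZeq ▸ Finset.mem_inter.mpr ⟨hpS, (mem_largeSet δ V p).mpr hle⟩)
      exact (chiPlaq_eq_one_iff δ p V).mpr (not_le.mp this)
    rw [h1, h2, mul_one, mul_one]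
  · -- a plaquette of `S` on which `Z` and the large-field set disagree
    have : ∃ p ∈ S, ¬ (p ∈ Z ↔ p ∈ largeSet δ V) := by
      by_contra hall
      push Not at hall
      apply hZeq
      ext p
      simp only [Finset.mem_inter]
      constructor
      · intro hp
        exact ⟨hZ hp, (hall p (hZ hp)).mp hp⟩
      · rintro ⟨hpS, hpL⟩
        exact (hall p hpS).mpr hpL
    obtain ⟨p, hpS, hp⟩ := this
    by_cases hpZ : p ∈ Z
    · have hsmall : dist1 (GaugeField.plaqHol V p) < δ := by
        have : p ∉ largeSet δ V := fun h => hp ⟨fun _ => h, fun _ => hpZ⟩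
        rwa [mem_largeSet, not_le] at this
      have h0 : ∏ q ∈ Z, (1 - chiPlaq δ q V) = 0 :=
        Finset.prod_eq_zero hpZ (by rw [(chiPlaq_eq_one_iff δ p V).mpr hsmall, sub_self])
      rw [h0, mul_zero, zero_mul]
    · have hlarge : δ ≤ dist1 (GaugeField.plaqHol V p) := by
        have : p ∈ largeSet δ V := by
          by_contra h
          exact hp ⟨fun h' => absurd h' hpZ, fun h' => absurd h' h⟩
        exact (mem_largeSet δ V p).mp this
      have h0 : ∏ q ∈ S \ Z, chiPlaq δ q V = 0 :=
        Finset.prod_eq_zero (Finset.mem_sdiff.mpr ⟨hpS, hpZ⟩) ((chiPlaq_eq_zero_iff δ p V).mpr hlarge)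
      rw [h0, mul_zero]

end Restricted

/-! ## §2 Stages, admissible histories, and the nested partition of unity -/

section Nested
variable [DecidableEq (Plaq P j)]

/-- A STAGE of the nested decomposition: the set of plaquettes it tests, AS A FUNCTION OF THE HISTORY of earlier outcomes (the
list of earlier large-field sets, oldest first), and its weights `χ_p`. [folklore] -/
structure Stage (P : Params) (j : ℕ) (G : Type*) where
  /-- the plaquettes tested at this stage, given the earlier outcomes -/
  tests : List (Finset (Plaq P j)) → Finset (Plaq P j)
  /-- the cut-off weights of this stage -/
  wt : Plaq P j → GaugeField P j G → ℝ

/-- The ADMISSIBLE HISTORIES of a list of stages after the history `hist`: outcome lists `[Z₀, Z₁, …]` with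
`Z₀ ⊆ tests₀ hist`, `Z₁ ⊆ tests₁ (hist ++ [Z₀])`, … . [folklore] -/
def admissible : List (Stage P j G) → List (Finset (Plaq P j)) → Finset (List (Finset (Plaq P j)))
  | [], _ => {[]}
  | s :: rest, hist => (s.tests hist).powerset.biUnion fun Z => (admissible rest (hist ++ [Z])).image (List.cons Z)

/-- The HISTORY PIECE: iterate the restricted pieces along the outcomes (junk `0`-free value `ρ` when the outcome list is
shorter than the stage list is never summed over; longer outcome lists ignore the excess). [folklore] -/
def nestedPiece : List (Stage P j G) → List (Finset (Plaq P j)) → Density P j G → List (Finset (Plaq P j)) → Density P j G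
  | [], _, ρ, _ => ρ
  | _ :: _, _, ρ, [] => ρ
  | s :: rest, hist, ρ, Z :: outs => nestedPiece rest (hist ++ [Z]) (lfPieceOn (s.tests hist) s.wt ρ Z) outs

/-- No stage: the only admissible history is the empty one. [folklore] -/
@[simp] theorem admissible_nil (hist : List (Finset (Plaq P j))) : admissible ([] : List (Stage P j G)) hist = {[]} := rfl

/-- One more stage: choose the first outcome `Z ⊆ tests hist`, then an admissible continuation. [folklore] -/
theorem admissible_cons (s : Stage P j G) (rest : List (Stage P j G)) (hist : List (Finset (Plaq P j))) :
    admissible (s :: rest) hist =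
      (s.tests hist).powerset.biUnion fun Z => (admissible rest (hist ++ [Z])).image (List.cons Z) := rfl

/-- No stage: the piece is the density. [folklore] -/
@[simp] theorem nestedPiece_nil (hist : List (Finset (Plaq P j))) (ρ : Density P j G) (outs : List (Finset (Plaq P j))) :
    nestedPiece ([] : List (Stage P j G)) hist ρ outs = ρ := by
  cases outs <;> rfl

/-- One more stage and outcome: restrict, then continue. [folklore] -/
@[simp] theorem nestedPiece_cons_cons (s : Stage P j G) (rest : List (Stage P j G)) (hist : List (Finset (Plaq P j)))
    (ρ : Density P j G) (Z : Finset (Plaq P j)) (outs : List (Finset (Plaq P j))) :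
    nestedPiece (s :: rest) hist ρ (Z :: outs) = nestedPiece rest (hist ++ [Z]) (lfPieceOn (s.tests hist) s.wt ρ Z) outs :=
  rfl

/-- **THE NESTED PARTITION OF UNITY**: summing the history pieces over all admissible histories returns the density — for ANY
outcome-dependent test sets and ANY real weights. [folklore] -/
theorem sum_nestedPiece : ∀ (stages : List (Stage P j G)) (hist : List (Finset (Plaq P j))) (ρ : Density P j G)
    (V : GaugeField P j G), ∑ outs ∈ admissible stages hist, nestedPiece stages hist ρ outs V = ρ V
  | [], hist, ρ, V => by simp
  | s :: rest, hist, ρ, V => by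
    rw [admissible_cons, Finset.sum_biUnion]
    · calc ∑ Z ∈ (s.tests hist).powerset, ∑ outs ∈ (admissible rest (hist ++ [Z])).image (List.cons Z),
              nestedPiece (s :: rest) hist ρ outs V
          = ∑ Z ∈ (s.tests hist).powerset, lfPieceOn (s.tests hist) s.wt ρ Z V := by
            refine Finset.sum_congr rfl fun Z _ => ?_
            rw [Finset.sum_image (fun a _ b _ h => List.cons_injective h)]
            simp only [nestedPiece_cons_cons]
            exact sum_nestedPiece rest (hist ++ [Z]) _ V
        _ = ρ V := lfPieceOn_total _ _ ρ V
    · -- the images with different first outcome are disjoint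
      intro Z _ Z' _ hne
      simp only [Function.onFun]
      rw [Finset.disjoint_left]
      intro outs h1 h2
      obtain ⟨a, -, rfl⟩ := Finset.mem_image.mp h1
      obtain ⟨b, -, hb⟩ := Finset.mem_image.mp h2
      exact hne (List.cons_eq_cons.mp hb).1.symm

/-- Positivity of the history pieces under `0 ≤ wt ≤ 1` at every stage and `0 ≤ ρ V`. [folklore] -/
theorem nestedPiece_nonneg : ∀ (stages : List (Stage P j G)) (hist : List (Finset (Plaq P j))) {ρ : Density P j G}
    (outs : List (Finset (Plaq P j))) {V : GaugeField P j G},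
    (∀ s ∈ stages, ∀ p V, 0 ≤ s.wt p V ∧ s.wt p V ≤ 1) → 0 ≤ ρ V → 0 ≤ nestedPiece stages hist ρ outs V
  | [], hist, ρ, outs, V, _, hρ => by simpa using hρ
  | s :: rest, hist, ρ, [], V, _, hρ => hρ
  | s :: rest, hist, ρ, Z :: outs, V, hwt, hρ => by
    rw [nestedPiece_cons_cons]
    refine nestedPiece_nonneg rest (hist ++ [Z]) outs (fun s' hs' => hwt s' (List.mem_cons_of_mem _ hs')) ?_
    exact lfPieceOn_nonneg_at _ (hwt s (List.mem_cons_self)) hρ Z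

/-- Domination `nestedPiece … ρ outs V ≤ ρ V` under the same hypotheses. [folklore] -/
theorem nestedPiece_le : ∀ (stages : List (Stage P j G)) (hist : List (Finset (Plaq P j))) {ρ : Density P j G}
    (outs : List (Finset (Plaq P j))) {V : GaugeField P j G},
    (∀ s ∈ stages, ∀ p V, 0 ≤ s.wt p V ∧ s.wt p V ≤ 1) → 0 ≤ ρ V → nestedPiece stages hist ρ outs V ≤ ρ V
  | [], hist, ρ, outs, V, _, _ => by simp
  | s :: rest, hist, ρ, [], V, _, _ => le_rfl
  | s :: rest, hist, ρ, Z :: outs, V, hwt, hρ => by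
    rw [nestedPiece_cons_cons]
    have h0 : 0 ≤ lfPieceOn (s.tests hist) s.wt ρ Z V := lfPieceOn_nonneg_at _ (hwt s (List.mem_cons_self)) hρ Z
    exact (nestedPiece_le rest (hist ++ [Z]) outs (fun s' hs' => hwt s' (List.mem_cons_of_mem _ hs')) h0).trans
      (lfPieceOn_le_at _ (hwt s (List.mem_cons_self)) hρ Z)

end Nested

/-! ## §3 The nested decomposition of record as `Setup.LargeFieldDecomp` data -/

section Packaging
variable [DecidableEq (Plaq P j)] [GaugeGroup G]

/-- **THE NESTED LARGE-FIELD DECOMPOSITION OF RECORD**: regions = the admissible histories of `stages` (from the empty history),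
pieces = the history pieces, non-negativity from the displayed witness `h` (e.g. `nestedPiece_nonneg`). [folklore] -/
def lfDecompNested (stages : List (Stage P j G)) (ρ : Density P j G)
    (h : ∀ outs ∈ admissible stages [], ∀ V, 0 ≤ nestedPiece stages [] ρ outs V) : LargeFieldDecomp P j G where
  Region := ↥(admissible stages [])
  piece := fun outs => nestedPiece stages [] ρ outs.1
  nonneg := fun outs V => h outs.1 outs.2 V

/-- Its pieces are the history pieces (definitional). [folklore] -/
theorem lfDecompNested_piece (stages : List (Stage P j G)) (ρ : Density P j G)
    (h : ∀ outs ∈ admissible stages [], ∀ V, 0 ≤ nestedPiece stages [] ρ outs V) (outs : ↥(admissible stages [])) :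
    (lfDecompNested stages ρ h).piece outs = nestedPiece stages [] ρ outs.1 := rfl

/-- **ITS TOTAL IS THE DENSITY** (`sum_nestedPiece` read through `Finset.sum_coe_sort`). [folklore] -/
theorem lfDecompNested_total (stages : List (Stage P j G)) (ρ : Density P j G)
    (h : ∀ outs ∈ admissible stages [], ∀ V, 0 ≤ nestedPiece stages [] ρ outs V) :
    (lfDecompNested stages ρ h).total = ρ := by
  funext V
  change ∑ outs : ↥(admissible stages []), nestedPiece stages [] ρ outs.1 V = ρ V
  rw [Finset.sum_coe_sort (admissible stages []) (fun outs => nestedPiece stages [] ρ outs V)]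
  exact sum_nestedPiece stages [] ρ V

/-- The nested decomposition from the STANDARD positivity witness (`0 ≤ wt ≤ 1` at every stage, `0 ≤ ρ`). [folklore] -/
def lfDecompNestedStd (stages : List (Stage P j G)) (ρ : Density P j G)
    (hwt : ∀ s ∈ stages, ∀ p V, 0 ≤ s.wt p V ∧ s.wt p V ≤ 1) (hρ : ∀ V, 0 ≤ ρ V) : LargeFieldDecomp P j G :=
  lfDecompNested stages ρ fun outs _ V => nestedPiece_nonneg stages [] outs hwt (hρ V)

/-- … with total `ρ`. [folklore] -/
theorem lfDecompNestedStd_total (stages : List (Stage P j G)) (ρ : Density P j G)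
    (hwt : ∀ s ∈ stages, ∀ p V, 0 ≤ s.wt p V ∧ s.wt p V ≤ 1) (hρ : ∀ V, 0 ≤ ρ V) :
    (lfDecompNestedStd stages ρ hwt hρ).total = ρ :=
  lfDecompNested_total stages ρ _

end Packaging

end Summit.QuantumFields.BalabanUV.T4Continuum.SubstrateLargeField
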